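import Literature.AlgebraicGeometry.HodgeTheory.PicardLefschetzOfLocalisation
import Literature.Geometry.ComplexAnalytic.OrdinaryDoublePointLocalisation
import HarnessLib

/-!
# The one-nodal Picard–Lefschetz datum from the monodromy homeomorphism of a pencil near an ordinary double point
# (the socket between the topological and the algebraic halves of Voisin II Thm. 3.16)

Family `hodge`, layer `Literature/AlgebraicGeometry/HodgeTheory`; proof file (theorems only, no definition, no named fact).
Written by the prover seat `hodge-nonav-prover-Bx` (g13, cell `hodge-nonav`) for crux K1-B `VeryGeneralSignCommutatorsInHg` of
the route `HodgeConjecture/SignSymmetricPowers` (stmt-HodgeConjecture-19716), binder hPL `picardLefschetz_nodalForms(_uniform)`.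
It composes the two halves landed this day:

* the TOPOLOGICAL interface `PhamBrieskorn.exists_localisation_of_homotopyConj_antipodal`
  (`Geometry/ComplexAnalytic/OrdinaryDoublePointLocalisation`): if the monodromy homeomorphism `h` of the fibre `Y` is the
  identity off an open `A` and on `A` is homotopy-conjugate, through a chart `e : A → {Σ zᵢ² = 1}` injective on middle homology,
  to the antipodal model monodromy, then `h^*` moves every class along one line `ℚ δ` on which it acts by `(−1)^{#variables}`;
* the ALGEBRAIC half `exists_isPicardLefschetzData_one_of_sub_mem_span` (`PicardLefschetzOfLocalisation`): such a localised
  rational transport of the universal family is a symplectic transvection / a reflection, i.e. a one-nodal `IsPicardLefschetzData`.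

Result: `exists_isPicardLefschetzData_one_of_homotopyConj_antipodal` — for the fibre `Y_{s'}` of the universal family of smooth
hypersurfaces of dimension `m + 1` in `ℙ^{m+2}_ℂ`, a loop `γ` at `s'` whose rational transport `T` on `H^{m+1}(Y_{s'}(ℂ); ℚ)` is
`h^*` for a self-map `h` of `Y_{s'}(ℂ)` carrying the above geometric datum (and, when the number of variables `m + 2` is odd —
even-dimensional fibres — `T ≠ 1`), there is a Picard–Lefschetz datum `IsPicardLefschetzData (m+1) d 1 … γ ![δ] c`. What then
remains of the Picard–Lefschetz theorem for one node is ONLY the construction of this geometric datum for the pencil circle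
(Milnor's fibration theorem at the node and the isotopy making the monodromy the identity off the ball — the programme that
discharged the cyclic fact F1‡, `HodgeTheory/CyclicCoverPencil*`), plus the equivariant sign rule.

## References

* [VoisinHodgeII2003] C. Voisin, Hodge Theory and Complex Algebraic Geometry II, CUP 2003, §2.3.1–§2.3.2 (Lefschetz
  degenerations, the monodromy is the identity off a ball), §3.2.1 Thm. 3.16.
* [ArnoldGuseinzadeVarchenko2012] Arnold, Gusein-Zade, Varchenko, Singularities of Differentiable Maps II, Part I §1.1–§1.3.
* [Artin1988] E. Artin, Geometric Algebra, Ch. III Thm. 3.17 and (3.39)–(3.41).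
-/

noncomputable section

open CategoryTheory AlgebraicGeometry ContinuousMap
open Literature.AlgebraicTopology.SingularHomology Literature.Geometry.ComplexAnalytic
open Literature.AlgebraicGeometry.Motives Literature.AlgebraicGeometry.Motives.UniversalHypersurface

namespace Literature.AlgebraicGeometry.HodgeTheory

section HodgeTheory

variable {m d : ℕ}

/-- **The one-nodal Picard–Lefschetz datum from the monodromy homeomorphism.** Universal family of smooth hypersurfaces of
dimension `m + 1` in `ℙ^{m+2}_ℂ` (`d ≥ 1`), trivialisation datum `hU`, a loop `γ` at `s'` with rational transport `T` on
`H^{m+1}(Y_{s'}(ℂ); ℚ)`; GEOMETRIC DATUM on `Y = Y_{s'}(ℂ)`: `Y = A ∪ B` open, `h : Y → Y` the identity on `B` with `h(A) ⊆ A`,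
a chart `e : A → F = {Σ_{i < m+2} zᵢ² = 1}` injective on `H_{m+1}(·; ℚ)` intertwining `h|_A` with the antipodal map of `F` up to
homotopy, and `T = h^*`; if the number of variables `m + 2` is odd assume moreover `T ≠ 1`. Then
`IsPicardLefschetzData (m+1) d 1 … γ ![δ] c` for some `δ, c` (`PhamBrieskorn.exists_localisation_of_homotopyConj_antipodal` feeding
`exists_isPicardLefschetzData_one_of_sub_mem_span`). [cite: VoisinHodgeII2003, §2.3.2 and §3.2.1 Thm. 3.16]
[cite: ArnoldGuseinzadeVarchenko2012, Part I §1.1 and §1.3] -/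
theorem exists_isPicardLefschetzData_one_of_homotopyConj_antipodal (hd : 1 ≤ d)
    (hU : IsCohomologicallyLocallyTrivialOn (family ℂ (m + 1) d) Set.univ) {s' : ComplexPoints (base ℂ (m + 1) d)}
    (γ : Path s' s')
    {T : bettiCohomology (fiberOver (family ℂ (m + 1) d) s') (m + 1) ≃ₗ[ℚ]
      bettiCohomology (fiberOver (family ℂ (m + 1) d) s') (m + 1)}
    (hT : IsRatTransport (family ℂ (m + 1) d) (m + 1) hU (loopClassUniv (m + 1) d γ) T)
    {A B : Set (ComplexPoints (fiberOver (family ℂ (m + 1) d) s'))} (hAo : IsOpen A) (hBo : IsOpen B)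
    (hAB : A ∪ B = Set.univ)
    (h : C(ComplexPoints (fiberOver (family ℂ (m + 1) d) s'), ComplexPoints (fiberOver (family ℂ (m + 1) d) s')))
    (hB : ∀ y ∈ B, h y = y) (hA : C(↥A, ↥A)) (hhA : ∀ a : ↥A, ((hA a : ↥A) : _) = h a)
    (e : C(↥A, PhamBrieskorn.fibre (fun _ : Fin (m + 2) ↦ (2 : ℕ))))
    (hinj : Function.Injective (singularHomology.map ℚ ℚ e (m + 1)).hom)
    (g : C(PhamBrieskorn.fibre (fun _ : Fin (m + 2) ↦ (2 : ℕ)), PhamBrieskorn.fibre (fun _ : Fin (m + 2) ↦ (2 : ℕ))))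
    (hg : ∀ z, ((g z : PhamBrieskorn.fibre _) : Fin (m + 2) → ℂ) = -(z : Fin (m + 2) → ℂ))
    (hconj : (e.comp hA).Homotopic (g.comp e))
    (hTh : ∀ x, T x = (singularCohomology.map ℚ ℚ h (m + 1)).hom x)
    (hnt : Odd (m + 1) ∨ T ≠ 1) :
    ∃ (δ : bettiCohomology (fiberOver (family ℂ (m + 1) d) s') (m + 1)) (c : ℚ),
      IsPicardLefschetzData (m + 1) d 1 (Nat.succ_pos m) hd hU γ ![δ] c := by
  obtain ⟨V, hV, hdim, -⟩ := PhamBrieskorn.exists_localisation_of_homotopyConj_antipodal hAo hBo hAB h hB hA hhA e hinj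
    g hg hconj T hTh
  -- `V ⊆ ℚ δ` for a single class `δ`
  haveI : Module.Finite ℚ (bettiCohomology (fiberOver (family ℂ (m + 1) d) s') (m + 1)) :=
    BettiUniverse.finite ((isSmoothProjectiveFamily_family ℂ (Nat.succ_pos m) hd).isSmoothProjective s') (m + 1)
  obtain ⟨v, hv⟩ := finrank_le_one_iff.1 hdim
  refine exists_isPicardLefschetzData_one_of_sub_mem_span (Nat.succ_pos m) hd hU γ hT (δ := (v : _)) (fun x ↦ ?_) hnt
  obtain ⟨a, ha⟩ := hv ⟨T x - x, hV x⟩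
  exact ⟨a, by rw [← Submodule.coe_smul, ha]⟩

end HodgeTheory

end Literature.AlgebraicGeometry.HodgeTheory

end
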